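import Mathlib
import Summits.Ventures.HodgeRepro.Tier4.Target
import Summits.Ventures.HodgeRepro.Tier4.Common.TargetBall
import Summits.Ventures.HodgeRepro.Tier4.Common.TargetCalculus

/-!
# Tier4/Common/TargetPositivity — the `L²` positivity of a non-zero holomorphic automorphic `2`-form over a
fundamental domain of the frozen target: `0 < ∫_D ‖h‖²` (the residual (T1) of typer-1's `concreteFormAlgebra`)

Blind re-derivation cell `pub-hodge-repro`, Tier 4 (README §9–§10), seat t4-typer-2 (gen 0).  Target tree path
`lean/Summits/Ventures/HodgeRepro/Tier4/Common/TargetPositivity.lean`.  Imports the FROZEN `Tier4/Target.lean`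
(`ball`, `actM`, `toBallMat`, `IsFundamentalDomainFor`, `ballActions`, `IsCongruenceSubgroup`, `IsSylvester`) and
`Tier4/Common/TargetBall.lean` (`actM_mul`, `actM_one'`, `actM_mem_ball`, `differentiableOn_actM`, `toBallMat_mul`,
`toBallMat_J`, `complexConj_intertwines`).

THE STATEMENT.  `X_{Γ′} = Γ′\𝔹²`; a holomorphic `2`-form on it is a holomorphic `h : 𝔹² → ℂ` with the automorphy
`h(γ z) · jacDetMap(γ, z) = h(z)` for `γ ∈ Γ′` (the coefficient of `h dz₀ ∧ dz₁` pulled back along `z ↦ γ z`);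
its `L²` norm over `X_{Γ′}` is `∫_D ‖h‖²` for a fundamental domain `D` (the target's `IsFundamentalDomainFor`).
**`setIntegral_normSq_pos`**: if `h` is not identically zero on the ball, the integral is POSITIVE.  Proof on the
kernel: `h ≠ 0` at a point ⇒ (continuity) `h ≠ 0` on an open `U ⊆ 𝔹²`, of positive Lebesgue measure; the
a.e.-cover clause of the fundamental domain and the COUNTABILITY of `Γ′` (a set of matrices over the number field
`E`, `Countable.of_moduleFinite`) give one translate `φ = actM M(γ)` with `vol (U ∩ φ⁻¹ D) > 0`
(`exists_translate_pos`); `φ` is a biholomorphism of the ball with inverse `actM M(γ⁻¹)`, so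
`vol (φ '' (U ∩ φ⁻¹ D)) > 0` (`volume_image_pos_of_inverse`: Mathlib's
`addHaar_image_eq_zero_of_differentiableOn_of_addHaar_eq_zero` applied to the INVERSE map); on `φ '' U` the
automorphy gives `h ≠ 0` (a product is non-zero only if both factors are); so `support ‖h‖² ∩ D ⊇ φ '' (U ∩ φ⁻¹ D)`
has positive measure and `setIntegral_pos_iff_support_of_nonneg_ae` concludes.  Integrability of `‖h‖²` over `D`
is a hypothesis (typer-1's `IsBddMeasOn D` supplies it: bounded on the finite-measure `D`).

WHY THIS IS THE RIGHT HYPOTHESIS SET (S12118): positivity is FALSE for merely bounded-measurable automorphic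
forms (the indicator of one Γ′-orbit, a null set, is automorphic and non-zero with zero integral); holomorphy —
continuity — is what makes a non-zero form non-zero on an open set.  Nothing here says anything about the status
of the Hodge conjecture for CM abelian varieties, which is NOT proved (HC_CM is NOT proved by anyone in this
repository).
-/

set_option autoImplicit false

noncomputable section

namespace Summit.Ventures.HodgeRepro.Tier4

open MeasureTheory Set Matrix
open scoped ComplexConjugate

/-! ## 1. Null-set transport under a map with a differentiable inverse -/

/-- If `φ` has a left inverse `ψ` on the ball that is holomorphic on the ball and `φ` maps the ball into itself,
then `φ` maps subsets of the ball of positive measure to sets of positive measure. -/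
theorem volume_image_pos_of_inverse {φ ψ : (Fin 2 → ℂ) → (Fin 2 → ℂ)} (hφ : MapsTo φ ball ball)
    (hψ : DifferentiableOn ℂ ψ ball) (hψφ : ∀ z ∈ ball, ψ (φ z) = z) {S : Set (Fin 2 → ℂ)} (hS : S ⊆ ball)
    (h : 0 < volume S) : 0 < volume (φ '' S) := by
  by_contra hcon
  have h0 : volume (φ '' S) = 0 := by
    rw [not_lt] at hcon
    exact le_antisymm hcon bot_le
  have himg : ψ '' (φ '' S) = S := by
    ext z
    constructor
    · rintro ⟨w, ⟨u, hu, rfl⟩, rfl⟩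
      rw [hψφ u (hS hu)]
      exact hu
    · intro hz
      exact ⟨φ z, ⟨z, hz, rfl⟩, hψφ z (hS hz)⟩
  have hsub : φ '' S ⊆ ball := by
    rintro w ⟨u, hu, rfl⟩
    exact hφ (hS hu)
  have hnull : volume (ψ '' (φ '' S)) = 0 :=
    addHaar_image_eq_zero_of_differentiableOn_of_addHaar_eq_zero volume
      ((hψ.restrictScalars ℝ).mono hsub) h0
  rw [himg] at hnull
  exact absurd hnull h.ne'

/-! ## 2. The a.e.-cover of a fundamental domain meets a positive-measure set in one translate -/

/-- The ball is open (local copy; typer-1's `isOpen_ball` of `AutForms.lean` is the name of record). -/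
theorem isOpen_ball_target : IsOpen ball := isOpen_lt (by unfold nsq; fun_prop) continuous_const

/-- The bad set of a fundamental domain (the points of the ball with no translate in `D`) is null. -/
theorem volume_bad_eq_zero {S : Set ((Fin 2 → ℂ) → (Fin 2 → ℂ))} {D : Set (Fin 2 → ℂ)}
    (hD : IsFundamentalDomainFor S D) : volume ({z | ¬ ∃ φ ∈ S, φ z ∈ D} ∩ ball) = 0 := by
  have h := hD.2.2.1
  rw [ae_iff, Measure.restrict_apply' isOpen_ball_target.measurableSet] at h
  exact h

/-- **One translate sees a positive-measure piece**: for a countable set `S` of self-maps with a fundamental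
domain `D`, every `U ⊆ 𝔹²` of positive measure has some `φ ∈ S` with `vol (U ∩ φ⁻¹ D) > 0`. -/
theorem exists_translate_pos {S : Set ((Fin 2 → ℂ) → (Fin 2 → ℂ))} (hS : S.Countable) {D : Set (Fin 2 → ℂ)}
    (hD : IsFundamentalDomainFor S D) {U : Set (Fin 2 → ℂ)} (hU : U ⊆ ball) (hpos : 0 < volume U) :
    ∃ φ ∈ S, 0 < volume (U ∩ φ ⁻¹' D) := by
  by_contra hcon
  have hnull : ∀ φ ∈ S, volume (U ∩ φ ⁻¹' D) = 0 := fun φ hφ => by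
    by_contra h0
    exact hcon ⟨φ, hφ, pos_iff_ne_zero.mpr h0⟩
  have hcover : U ⊆ ({z | ¬ ∃ φ ∈ S, φ z ∈ D} ∩ ball) ∪ ⋃ φ ∈ S, (U ∩ φ ⁻¹' D) := by
    intro z hz
    by_cases hex : ∃ φ ∈ S, φ z ∈ D
    · obtain ⟨φ, hφ, hφz⟩ := hex
      exact Or.inr (mem_iUnion₂.mpr ⟨φ, hφ, hz, hφz⟩)
    · exact Or.inl ⟨hex, hU hz⟩
  have hU0 : volume U = 0 := by
    refine measure_mono_null hcover (measure_union_null (volume_bad_eq_zero hD) ?_)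
    exact (measure_biUnion_null_iff hS).mpr hnull
  exact absurd hU0 hpos.ne'

/-! ## 3. Holomorphic automorphic `2`-forms: positivity of the `L²` norm -/

section Positivity

variable {E : Type} [Field E] [NumberField E] {c : E ≃+* E} {H : Matrix (Fin 3) (Fin 3) E} {τ₀ : E →+* ℂ}
  {C : Matrix (Fin 3) (Fin 3) ℂ} {Γ' : Set (Matrix (Fin 3) (Fin 3) E)}

/-- The matrices over a number field form a countable type. -/
theorem countable_matrix_numberField : Countable (Matrix (Fin 3) (Fin 3) E) := by
  haveI : Countable E := Finsupp.Countable.of_moduleFinite (R := ℚ)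
  exact inferInstanceAs (Countable (Fin 3 → Fin 3 → E))

/-- The set of ball actions of a congruence subgroup is countable. -/
theorem countable_ballActions (τ₀ : E →+* ℂ) (C : Matrix (Fin 3) (Fin 3) ℂ) (Γ' : Set (Matrix (Fin 3) (Fin 3) E)) :
    (ballActions τ₀ C Γ').Countable := by
  haveI := countable_matrix_numberField (E := E)
  exact (Set.to_countable Γ').image _

omit [NumberField E] in
/-- Every element of a congruence subgroup has an inverse in it which is a two-sided matrix inverse. -/
theorem IsCongruenceSubgroup.exists_inv_mem (hΓ' : IsCongruenceSubgroup c H Γ') {γ : Matrix (Fin 3) (Fin 3) E}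
    (hγ : γ ∈ Γ') : ∃ δ ∈ Γ', γ * δ = 1 ∧ δ * γ = 1 := by
  obtain ⟨δ, hδ, h1⟩ := hΓ'.2.2.1 γ hγ
  exact ⟨δ, hδ, h1, mul_eq_one_comm.mp h1⟩

omit [NumberField E] in
/-- The ball action of `γ ∈ Γ′` is inverted on the ball by the action of its inverse `δ`. -/
theorem actM_inv_left (hτ : ∀ x, τ₀ (c x) = conj (τ₀ x)) (hC : IsSylvester (H.map τ₀) C)
    (hΓ' : IsCongruenceSubgroup c H Γ') {γ δ : Matrix (Fin 3) (Fin 3) E} (hγ : γ ∈ Γ') (hδγ : δ * γ = 1)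
    {z : Fin 2 → ℂ} (hz : z ∈ ball) : actM (toBallMat τ₀ C δ) (actM (toBallMat τ₀ C γ) z) = z := by
  have hγJ : (toBallMat τ₀ C γ)ᴴ * J * toBallMat τ₀ C γ = J := toBallMat_J τ₀ c hτ hC (hΓ'.2.2.2.1 hγ).1
  rw [← actM_mul hγJ hz, ← toBallMat_mul τ₀ hC.1, hδγ, toBallMat_one τ₀ hC.1, actM_one']

/-- **`L²` positivity of a non-zero holomorphic automorphic `2`-form over a fundamental domain.**  `h` holomorphic
on the ball with the automorphy `h (γ·z) · jacDetMap (actM M(γ)) z = h z` for `γ ∈ Γ′`, `‖h‖²` integrable over the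
fundamental domain `D`, and `h` not identically zero on the ball: then `0 < ∫_D ‖h‖²`. -/
theorem setIntegral_normSq_pos (hτ : ∀ x, τ₀ (c x) = conj (τ₀ x)) (hC : IsSylvester (H.map τ₀) C)
    (hΓ' : IsCongruenceSubgroup c H Γ') {D : Set (Fin 2 → ℂ)} (hD : IsFundamentalDomainFor (ballActions τ₀ C Γ') D)
    {h : (Fin 2 → ℂ) → ℂ} (hh : DifferentiableOn ℂ h ball)
    (hinv : ∀ γ ∈ Γ', ∀ z ∈ ball, h (actM (toBallMat τ₀ C γ) z) * jacDetMap (actM (toBallMat τ₀ C γ)) z = h z)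
    (hint : IntegrableOn (fun z => ‖h z‖ ^ 2) D volume) (hne : ∃ z ∈ ball, h z ≠ 0) :
    0 < ∫ z in D, ‖h z‖ ^ 2 := by
  obtain ⟨z₀, hz₀, hz₀ne⟩ := hne
  have hopen : IsOpen ball := isOpen_ball_target
  -- an open set around `z₀` inside the ball where `h ≠ 0`
  have hcont : ContinuousAt h z₀ := hh.continuousOn.continuousAt (hopen.mem_nhds hz₀)
  have hev : ∀ᶠ z in nhds z₀, h z ≠ 0 ∧ z ∈ ball := (hcont.eventually_ne hz₀ne).and (hopen.mem_nhds hz₀)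
  obtain ⟨U, hUsub, hUopen, hz₀U⟩ := _root_.eventually_nhds_iff.mp hev
  have hUball : U ⊆ ball := fun z hz => (hUsub z hz).2
  have hUne : ∀ z ∈ U, h z ≠ 0 := fun z hz => (hUsub z hz).1
  have hUpos : 0 < volume U := hUopen.measure_pos volume ⟨z₀, hz₀U⟩
  -- one translate with a positive-measure piece landing in `D`
  obtain ⟨φ, hφS, hφpos⟩ := exists_translate_pos (countable_ballActions τ₀ C Γ') hD hUball hUpos
  obtain ⟨γ, hγ, rfl⟩ := hφS
  obtain ⟨δ, -, -, hδγ⟩ := hΓ'.exists_inv_mem hγ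
  have hγJ : (toBallMat τ₀ C γ)ᴴ * J * toBallMat τ₀ C γ = J := toBallMat_J τ₀ c hτ hC (hΓ'.2.2.2.1 hγ).1
  have hδJ : (toBallMat τ₀ C δ)ᴴ * J * toBallMat τ₀ C δ = J := by
    have hδ' : δ ∈ Γ' := by
      obtain ⟨δ', hδ', h1, h2⟩ := hΓ'.exists_inv_mem hγ
      have : δ = δ' := by
        calc δ = δ * (γ * δ') := by rw [h1, Matrix.mul_one]
          _ = δ' := by rw [← Matrix.mul_assoc, hδγ, Matrix.one_mul]
      rw [this]; exact hδ'
    exact toBallMat_J τ₀ c hτ hC (hΓ'.2.2.2.1 hδ').1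
  set φ := actM (toBallMat τ₀ C γ) with hφ_def
  set S := U ∩ φ ⁻¹' D with hS_def
  have hSball : S ⊆ ball := fun z hz => hUball hz.1
  have hφmaps : MapsTo φ ball ball := fun z hz => actM_mem_ball hγJ hz
  have himgpos : 0 < volume (φ '' S) :=
    volume_image_pos_of_inverse hφmaps (differentiableOn_actM hδJ)
      (fun z hz => actM_inv_left hτ hC hΓ' hγ hδγ hz) hSball hφpos
  -- `φ '' S ⊆ support ‖h‖² ∩ D`
  have hsub : φ '' S ⊆ Function.support (fun z => ‖h z‖ ^ 2) ∩ D := by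
    rintro w ⟨u, ⟨huU, huD⟩, rfl⟩
    refine ⟨?_, huD⟩
    have hu : h (φ u) * jacDetMap φ u = h u := hinv γ hγ u (hUball huU)
    have hne' : h (φ u) ≠ 0 := fun h0 => hUne u huU (by rw [← hu, h0, zero_mul])
    simp only [Function.mem_support, ne_eq]
    have : ‖h (φ u)‖ ≠ 0 := norm_ne_zero_iff.mpr hne'
    positivity
  have hsupp : 0 < volume (Function.support (fun z => ‖h z‖ ^ 2) ∩ D) := lt_of_lt_of_le himgpos (measure_mono hsub)
  exact (setIntegral_pos_iff_support_of_nonneg_ae (Filter.Eventually.of_forall fun z => by positivity) hint).mpr hsupp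

end Positivity

end Summit.Ventures.HodgeRepro.Tier4

end
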